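import Summits.AtomisticToContinuum.BoseEinsteinCondensation.Theses.BECStronglyRayleigh
import Literature.MathematicalPhysics.QuantumLattice.LiebMattisSectorPF

/-!
# Disproof work file — crux `BECStronglyRayleigh.GroundStateStability` (stmt-AtomisticToContinuum-9672)

Standing adversary (cdisprove seat `refuter-cdisprove-stmt-AtomisticToContinuum-9672-0`). Prose lives in
docstrings; everything named `…_false_…` / `not_…` below is kernel-checked unless marked `sorry` (near-miss).

## Findings (cycle 1, 2026-08-16)

* **No kill.** The crux is, as far as every attack here can tell, TRUE: the bond Gibbs factor
  `e^{-τ h_b}`, `h_b = -(SˣSˣ+SʸSʸ+ΔSᶻSᶻ)`, has Borcea–Brändén symbol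
  `κ(z_xz_y + w_xw_y) + C(z_xw_x + z_yw_y) + S(z_xw_y + z_yw_x)` (`κ = e^{τΔ/2}`, `C = cosh(τ/2)`,
  `S = sinh(τ/2)`), whose Hessian has the Klein-character eigenvalues `κ+C+S`, `κ-(C+S)`, `-(κ+C-S)`,
  `(C-S)-κ`; exactly one is positive iff `e^{-τ/2} ≤ κ ≤ e^{τ/2}` iff `|Δ| ≤ 1`, so each bond factor is a
  stability preserver (BB Thm 2.1(b); tree `multiAffine_kernel_stable_or_zero`), site factors are positive
  rescalings, Trotter + Hurwitz + sector Perron–Frobenius finish. Re-derived independently in this seat;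
  agrees with the route card, triage r1-1 and the picked line's stubs A–F (each stub re-read here and judged
  true as stated — see `## Targets`).
* **Load-bearing hypotheses, as theorems** (section `LoadBearing`):
  - connectivity of `G` — `groundStateStability_false_without_connected` (two isolated sites, `H = 0`,
    the antisymmetric sector vector `δ_{↑↓} - δ_{↓↑}` is a ground vector with polynomial `∝ z₀ - z₁`,
    zero at `z = (i, i)`);
  - the ferromagnetic / bosonic sign `J = -1` — `groundStateStability_false_with_antiferro_sign`
    (`J = +1`, one bond, `Δ = 1`: the singlet is THE sector ground vector, by the tree's Marshall–Lieb–Mattis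
    theorem `LiebMattis.sector_perronFrobenius`; its polynomial `∝ z₀ - z₁`);
  - "ground" (not merely "eigen") — `groundStateStability_false_without_groundState` (same singlet is an
    excited eigenvector of the ferromagnet `-H_AF`);
  - the magnetisation-sector restriction — `groundStateStability_false_without_sector` (one site, `H = 0`:
    the cross-sector superposition `|↑⟩ - i|↓⟩` is a global ground vector with polynomial `z₀ - i`).
  None of these needs a matrix element: the witnesses ride on `H = 0` or on the tree's sector
  Perron–Frobenius for the antiferromagnet.
* **Tightness of the window `|Δ| ≤ 1` — as a theorem** (section `Tightness`):
  `groundStateStability_false_with_window : ¬ GroundStateStabilityWithWindow (7/3)` — the crux with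
  `|Δ| ≤ 1` replaced by `|Δ| ≤ 7/3` is FALSE. Witness: the 4-cycle `C4`, two particles, no field,
  `Δ = -7/3` (repulsive `V = 7/3 > 2J`): the sector ground vector is `ψ₀ = 3` on the diagonal pairs
  `{0,2}`, `{1,3}` and `1` on the four edges, `E_min = -3` (kernel-checked: the action formula
  `H_C4_apply`, the eigen-equation `H₀_mulVec_ψ₀`, the sum-of-squares certificate `quadForm_H₀`
  `⟨φ,(H₀+3)φ⟩ = 3Σ_i|a_i - (d₁+d₂)/6|² + ⅓|d₁-d₂|²`, hence `lowestEnergyInSector_H₀ = -3`), and its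
  polynomial `3(z₀z₂+z₁z₃) + (z₀z₁+z₁z₂+z₂z₃+z₃z₀)` vanishes at `(3+i, -4+2i, 3+i, -2+i) ∈ H⁴`
  (`ψ₀_poly_zero`). The exact picture behind it (by hand, this seat): on `C4`, `N = 2`, `μ = 0` the
  symmetric reduction is 2×2, `E² - ΔE - 2 = 0`, `ψ = (a` on diagonals`, b` on edges`)` with
  `b/a = 1/|E|`; the pair kernel `circ(0,b,a,b)` has eigenvalues `2b+a, a-2b, -a, -a`, so the ground
  vector is stable iff `a ≤ 2b` iff `|E| ≤ 2` iff **`Δ ≥ -1` exactly** — the window's repulsive edge is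
  sharp already on the smallest graph that can fail (rational instances: `Δ = -7/3, -17/10, -31/21, …,
  -(8i²-1)/(8i²-6i+1) → -1⁻`). The attractive edge `Δ ≤ 1` is NOT tight on `C4`/`C5` (`C5`: unstable iff
  `Δ < 1-√5` or `Δ > 1+√5`); where it first bites is graph-dependent (numerics: kit job ids in NOTES.md).
  General reusable API proved on the way: `onSite_mul_onSite_mulVec_apply`, `xxzBond_mulVec_apply`
  (occupation-basis action of the spin-½ XXZ bond: `Δ s_x s_y φ(σ) + ½[σ_x ≠ σ_y] φ(σ^{xy})`).
* **Refuted natural strengthenings**: "every eigenvector", "either sign of J", "no sector restriction"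
  (theorems above); and — as a THEOREM — "the squared amplitudes are also stable":
  `groundStateStability_false_squared : ¬ GroundStateStabilitySquared` (same hypotheses, conclusion for
  `ψ(1_S)²`, i.e. the Born weights `|Ψ₀|²` of the Perron vector): 4-cycle, `N = 2`, `μ = 0`, `Δ = -1/6`
  (inside the window!), `ψ₁ = (3` diag`, 2` edge`)`, `E_min = -3/2` (SOS `quadForm_H₁`), `ψ₁² = (9,4)` has
  pair kernel `circ(0,4,9,4)` with two positive eigenvalues; zero of `9(z₀z₂+z₁z₃)+4Σ_edges` at
  `(6+2i, -6+i, 6+i, -6+2i)`. By hand: on `C4` the Born weights are stable iff `Δ ≥ 0`, critical exactly at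
  pure hopping `Δ = 0` (where the card's conjecture P lives) — so P cannot survive ANY repulsion, and the
  boson positions under `|Ψ₀|²` are not a strongly Rayleigh point process in general although `Ψ₀`'s
  generating polynomial is stable. NOT refuted (true by the same proof): bond-dependent couplings
  `J_b > 0`, `|Δ_b| ≤ 1`.

## Numerics (this seat, pure python, power iteration to residual 1e-15; pair-kernel Lorentzian test)
Boundary `Δ = ±1` and `±0.99`, all sectors `N ≤ 4`, graphs P4–P7, C4–C7, K4, K_{1,4}, K_{2,3}, diamond, paw,
bowtie, 2×3 grid, 3-cube: **0 violations**; at `Δ = -1` every BIPARTITE graph has `λ₂(K_T) = 0` to 1e-17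
(exactly degenerate-Lorentzian kernels — the `SU(2)` point; explains why the repulsive edge is sharp), the
non-bipartite ones have `λ₂ < 0` strictly. First failure outside the window (grid 0.02): repulsive side
`-1.02` on P4, P5, P6, P7, C4, C6, K_{2,3}, 2×3 grid, cube; `-1.24` on C5 (exact `1-√5`), `-1.12` / `-1.04` on C7,
`-3.1` diamond, none ≤ 6 on paw/bowtie/K4/star; attractive side `1.64` (P4), `1.32` (P5), `1.20` (P6),
`1.14` / `1.12` (P7), `1.6` (bowtie, 2×3), `2.1` (C6), `1.6` (C7), `3.1` (paw, cube), `3.3` (C5), none on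
C4/K4/star/diamond/K_{2,3}. (An earlier run with a crude eigensolver showed spurious "violations" at
`Δ = -1.0`; they vanish at residual 1e-15 — recorded so nobody chases them.) With random fields (accurate solver): 480 sector ground states at `Δ = ±1` exactly on 40 random connected
graphs (`5 ≤ n ≤ 8`, `N = 2,3`, fields `μ_x ~ U(-f,f)`, `f ∈ {0,2,8}`): 0 violations (worst `λ₂/λ₁ = 1.5e-16`, worst
normalised Brändén–Rayleigh quotient `+2.2e-10`). Kit job j007926 (numpy sweep incl. random graphs to 10 sites)
queued at the time of writing.


## Landed in the Negative lane (importable)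
* `Summits/…/Theorems/GroundStateStability/Negative/LoadBearing.lean` (p74797): the four load-bearing lemmas.
* `Summits/…/Theorems/GroundStateStability/Negative/WindowTightness.lean` (p74968): `groundStateStability_false_with_window`
  + the 4-cycle machinery (`H_C4_apply`, `sum_sector`, …).
* `Summits/…/Theorems/GroundStateStability/Negative/BornWeights.lean` (p75158): `groundStateStability_false_squared`.
* The occupation-basis action formula first written here (`xxzBond_mulVec_apply`) was adopted by the positive line as
  `gate_xxzBond_mulVec_apply` (`Theorems/BECStronglyRayleighGroundStateStabilityEulerGate.lean`, stub A landed).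
## Targets
No stuck stubs yet (payload `stuck_stubs = []`). Stubs A–F of `Lines/stable-cone-variational-selection.lean`
were each attacked on paper (degenerate corners `ε = 0`, `Δ = ±1`, `|Λ| = 1`, empty sector, complex `φ`,
complex eigenvalue `c` in stub E(4), non-bipartite `G` in stub F): no counterexample; notes per stub in NOTES.md.
-/

noncomputable section

namespace Summit.AtomisticToContinuum.BoseEinsteinCondensation.Cruxes.GroundStateStability.Disproof

open scoped BigOperators Matrix ComplexOrder
open Literature.MathematicalPhysics.QuantumLattice Matrix Complex

/-! ### The crux with the coupling sign as a parameter -/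

/-- The crux statement with the XXZ coupling `J` exposed (`GroundStateStability` is `J = -1`, the
ferromagnetic-XY = hard-core-boson sign). [folklore] -/
def GroundStateStabilityWithCoupling (J : ℝ) : Prop :=
  ∀ (Λ : Type) [Fintype Λ] [DecidableEq Λ] (G : SimpleGraph Λ) [DecidableRel G.Adj], G.Connected →
    ∀ (Δ : ℝ) (μ : Λ → ℝ), |Δ| ≤ 1 → ∀ (M : ℝ) (ψ : TensorIndex Λ 2 → ℂ), ψ ∈ spinZSector 1 M → ψ ≠ 0 →
      (xxzHamiltonian 1 G J Δ + ∑ x : Λ, ((μ x : ℝ) : ℂ) • siteSpin 1 x 2).mulVec ψ =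
        ((lowestEnergyInSector 1 (xxzHamiltonian 1 G J Δ + ∑ x : Λ, ((μ x : ℝ) : ℂ) • siteSpin 1 x 2) M : ℝ) : ℂ) • ψ →
      ∀ z : Λ → ℂ, (∀ x, 0 < (z x).im) → (∑ S : Finset Λ, ψ (fun x => if x ∈ S then 0 else 1) * ∏ x ∈ S, z x) ≠ 0

/-- `GroundStateStability` is literally the `J = -1` instance. [folklore] -/
theorem groundStateStabilityWithCoupling_neg_one_iff :
    GroundStateStabilityWithCoupling (-1) ↔
      Summit.AtomisticToContinuum.BoseEinsteinCondensation.Theses.BECStronglyRayleigh.GroundStateStability :=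
  Iff.rfl

/-! ### Two identities between tree Hamiltonians -/

/-- At the isotropic point the XXZ Hamiltonian is the Heisenberg Hamiltonian:
`xxzHamiltonian n G J 1 = heisenbergHamiltonian n G J`. [folklore] -/
theorem xxzHamiltonian_one_eq_heisenberg {Λ : Type*} [Fintype Λ] [DecidableEq Λ] (n : ℕ)
    (G : SimpleGraph Λ) [DecidableRel G.Adj] (J : ℝ) :
    xxzHamiltonian n G J 1 = heisenbergHamiltonian n G J := by
  unfold xxzHamiltonian heisenbergHamiltonian
  congr 1
  refine Finset.sum_congr rfl fun e _ => ?_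
  induction e using Sym2.ind with
  | h x y => simp [spinDot, Fin.sum_univ_three]

/-- `heisenbergHamiltonian n G (-1) = -heisenbergHamiltonian n G 1` (ferro = minus antiferro). [folklore] -/
theorem heisenbergHamiltonian_neg_one {Λ : Type*} [Fintype Λ] [DecidableEq Λ] (n : ℕ)
    (G : SimpleGraph Λ) [DecidableRel G.Adj] :
    heisenbergHamiltonian n G (-1) = -heisenbergHamiltonian n G 1 := by
  unfold heisenbergHamiltonian
  simp

/-! ### The two-site singlet witness -/

/-- **Two-site singlet.** On one bond (`Λ = Fin 2`, `G = ⊤`) the antiferromagnetic Heisenberg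
Hamiltonian `heisenbergHamiltonian 1 ⊤ 1 = 𝐒₀·𝐒₁` has, in the sector of one up-spin, a ground vector `ψ`
(the singlet, obtained here abstractly from the tree's Marshall–Lieb–Mattis theorem, so no matrix element
is computed) whose occupation polynomial `ψ(↑↓) z₀ + ψ(↓↑) z₁` has the Marshall sign pattern `(+,-)` and
hence a zero with `Im z₀, Im z₁ > 0`. [folklore] -/
theorem singlet_witness :
    ∃ ψ : TensorIndex (Fin 2) 2 → ℂ,
      ψ ∈ spinZSector 1 (((Fintype.card (Fin 2) * 1 : ℕ) : ℝ) / 2 - (1 : ℕ)) ∧ ψ ≠ 0 ∧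
      heisenbergHamiltonian 1 (⊤ : SimpleGraph (Fin 2)) 1 *ᵥ ψ =
        ((lowestEnergyInSector 1 (heisenbergHamiltonian 1 (⊤ : SimpleGraph (Fin 2)) 1)
          (((Fintype.card (Fin 2) * 1 : ℕ) : ℝ) / 2 - (1 : ℕ)) : ℝ) : ℂ) • ψ ∧
      ∃ z : Fin 2 → ℂ, (∀ x, 0 < (z x).im) ∧
        (∑ S : Finset (Fin 2), ψ (fun x => if x ∈ S then 0 else 1) * ∏ x ∈ S, z x) = 0 := by
  have hconn : (⊤ : SimpleGraph (Fin 2)).Connected := SimpleGraph.connected_top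
  have hbip : (⊤ : SimpleGraph (Fin 2)).IsBipartiteWith ((({0} : Finset (Fin 2)) : Set (Fin 2)))
      ((({0} : Finset (Fin 2)) : Set (Fin 2)))ᶜ := by
    refine ⟨disjoint_compl_right, ?_⟩
    intro v w h
    fin_cases v <;> fin_cases w <;> simp_all
  have hW : ∃ σ : TensorIndex (Fin 2) 2, (∑ z, (σ z : ℕ)) = 1 :=
    ⟨fun x => if x ∈ ({0} : Finset (Fin 2)) then 0 else 1, by decide⟩
  obtain ⟨⟨ψ, hψ, hψ0, hH⟩, -, -, hmarshall⟩ :=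
    LiebMattis.sector_perronFrobenius 1 (⊤ : SimpleGraph (Fin 2)) 1 ({0} : Finset (Fin 2)) hconn hbip
      one_pos 1 hW
  obtain ⟨c, hc0, hsign⟩ := hmarshall ψ hψ hH hψ0
  refine ⟨ψ, hψ, hψ0, hH, ?_⟩
  -- the two weight-one configurations `↑↓ = 1_{ {0} }` and `↓↑ = 1_{ {1} }`
  set σa : TensorIndex (Fin 2) 2 := fun x => if x ∈ ({0} : Finset (Fin 2)) then 0 else 1 with hσa
  set σb : TensorIndex (Fin 2) 2 := fun x => if x ∈ ({1} : Finset (Fin 2)) then 0 else 1 with hσb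
  have hwa : (∑ z, (σa z : ℕ)) = 1 := by rw [hσa]; decide
  have hwb : (∑ z, (σb z : ℕ)) = 1 := by rw [hσb]; decide
  have hma : marshallSign ({0} : Finset (Fin 2)) σa = 1 := by
    have : ((σa 0 : Fin 2) : ℕ) = 0 := by rw [hσa]; decide
    simp [marshallSign, this]
  have hmb : marshallSign ({0} : Finset (Fin 2)) σb = -1 := by
    have : ((σb 0 : Fin 2) : ℕ) = 1 := by rw [hσb]; decide
    simp [marshallSign, this]
  obtain ⟨ha_pos, ha_im⟩ := hsign σa hwa
  obtain ⟨hb_pos, hb_im⟩ := hsign σb hwb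
  rw [hma] at ha_pos ha_im
  rw [hmb] at hb_pos hb_im
  -- the zero: z₀ = i·(-c ψ(↓↑)) , z₁ = i·(c ψ(↑↓)), both with positive imaginary part
  refine ⟨![I * (c * (-1) * ψ σb), I * (c * 1 * ψ σa)], ?_, ?_⟩
  · intro x
    fin_cases x
    · simpa using hb_pos
    · simpa using ha_pos
  · -- only `S = {0}` and `S = {1}` contribute (sector support), and those two terms cancel
    have hw := (LiebMattis.mem_spinZSector_weight_iff 1 1 ψ).1 hψ
    have hvan : ∀ S : Finset (Fin 2), S ≠ {0} ∧ S ≠ {1} →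
        ψ (fun x => if x ∈ S then 0 else 1) * ∏ x ∈ S, (![I * (c * (-1) * ψ σb), I * (c * 1 * ψ σa)] : Fin 2 → ℂ) x = 0 := by
      intro S hS
      have hS' : S = ∅ ∨ S = {0, 1} := by
        revert S
        decide
      rcases hS' with rfl | rfl
      · rw [hw _ (by decide), zero_mul]
      · rw [hw _ (by decide), zero_mul]
    rw [Fintype.sum_eq_add ({0} : Finset (Fin 2)) {1} (by decide) hvan, Finset.prod_singleton,
      Finset.prod_singleton]
    simp only [Matrix.cons_val_zero, Matrix.cons_val_one]
    rw [← hσa, ← hσb]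
    ring

/-! ### Load-bearing hypotheses -/

section LoadBearing

/-- The crux WITHOUT the hypothesis `G.Connected`. [folklore] -/
def GroundStateStabilityWithoutConnected : Prop :=
  ∀ (Λ : Type) [Fintype Λ] [DecidableEq Λ] (G : SimpleGraph Λ) [DecidableRel G.Adj],
    ∀ (Δ : ℝ) (μ : Λ → ℝ), |Δ| ≤ 1 → ∀ (M : ℝ) (ψ : TensorIndex Λ 2 → ℂ), ψ ∈ spinZSector 1 M → ψ ≠ 0 →
      (xxzHamiltonian 1 G (-1) Δ + ∑ x : Λ, ((μ x : ℝ) : ℂ) • siteSpin 1 x 2).mulVec ψ =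
        ((lowestEnergyInSector 1 (xxzHamiltonian 1 G (-1) Δ + ∑ x : Λ, ((μ x : ℝ) : ℂ) • siteSpin 1 x 2) M : ℝ) : ℂ) • ψ →
      ∀ z : Λ → ℂ, (∀ x, 0 < (z x).im) → (∑ S : Finset Λ, ψ (fun x => if x ∈ S then 0 else 1) * ∏ x ∈ S, z x) ≠ 0

/-- A sum over the edges of the empty graph vanishes (for ANY `Fintype` instance on its edge set —
the instance hidden in `xxzHamiltonian 1 ⊥ J Δ` is not the canonical `fintypeEdgeSetBot`). [folklore] -/
theorem sum_edgeFinset_bot {V : Type*} {β : Type*} [AddCommMonoid β]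
    [Fintype (⊥ : SimpleGraph V).edgeSet] (f : Sym2 V → β) :
    ∑ e ∈ (⊥ : SimpleGraph V).edgeFinset, f e = 0 := by
  refine Finset.sum_eq_zero fun e he => ?_
  rw [SimpleGraph.mem_edgeFinset, SimpleGraph.edgeSet_bot] at he
  exact absurd he (Set.notMem_empty e)

/-- The sector energy of the zero Hamiltonian is `0` (whether or not the sector is empty:
`sInf ∅ = 0 = sInf {0}`). [folklore] -/
theorem lowestEnergyInSector_zero {Λ : Type*} [Fintype Λ] [DecidableEq Λ] (M : ℝ) :
    lowestEnergyInSector (Λ := Λ) 1 0 M = 0 := by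
  unfold lowestEnergyInSector Matrix.minEnergyOn
  apply le_antisymm
  · apply Real.sInf_nonpos
    rintro E ⟨φ, -, -, rfl⟩
    simp
  · apply Real.sInf_nonneg
    rintro E ⟨φ, -, -, rfl⟩
    simp

/-- **Connectivity is load-bearing**: on two isolated sites (`G = ⊥`, `H = 0`) every sector vector
is a sector ground vector, in particular the antisymmetric one-particle vector, whose polynomial
`∝ z₀ - z₁` vanishes at `z = (i, i)`-type points. Any proof of the crux must use `G.Connected`
(it enters through Perron–Frobenius uniqueness). [folklore] -/
theorem groundStateStability_false_without_connected : ¬ GroundStateStabilityWithoutConnected := by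
  intro h
  obtain ⟨ψ, hψ, hψ0, -, z, hz, hzero⟩ := singlet_witness
  have hop0 : xxzHamiltonian 1 (⊥ : SimpleGraph (Fin 2)) (-1) 0 +
      ∑ x : Fin 2, (((fun _ : Fin 2 => (0 : ℝ)) x : ℝ) : ℂ) • siteSpin 1 x 2 = 0 := by
    simp [xxzHamiltonian, sum_edgeFinset_bot]
  refine h (Fin 2) (⊥ : SimpleGraph (Fin 2)) 0 (fun _ => 0) (by norm_num) _ ψ hψ hψ0 ?_ z hz hzero
  rw [hop0, lowestEnergyInSector_zero]
  simp

/-- **The ferromagnetic (bosonic) sign is load-bearing**: with the antiferromagnetic sign `J = +1`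
(one bond, `Δ = 1`, no field) the sector ground vector is the singlet, whose polynomial `∝ z₀ - z₁` has
zeros in `H²`. So no argument insensitive to the sign of the hopping can prove the crux; on bipartite
graphs the `J = +1` ground state is the Marshall-signed boson ground state, which is stable in the
mixed half-planes `(H)^A × (-H)^{Aᶜ}` instead. [folklore] -/
theorem groundStateStability_false_with_antiferro_sign : ¬ GroundStateStabilityWithCoupling 1 := by
  intro h
  obtain ⟨ψ, hψ, hψ0, hH, z, hz, hzero⟩ := singlet_witness
  have hH0 : xxzHamiltonian 1 (⊤ : SimpleGraph (Fin 2)) 1 1 +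
      ∑ x : Fin 2, (((fun _ : Fin 2 => (0 : ℝ)) x : ℝ) : ℂ) • siteSpin 1 x 2 =
      heisenbergHamiltonian 1 (⊤ : SimpleGraph (Fin 2)) 1 := by
    rw [xxzHamiltonian_one_eq_heisenberg]
    simp
  refine h (Fin 2) (⊤ : SimpleGraph (Fin 2)) SimpleGraph.connected_top 1 (fun _ => 0) (by norm_num) _ ψ
    hψ hψ0 ?_ z hz hzero
  rw [hH0]
  exact hH

/-- The crux with "sector ground vector" weakened to "eigenvector of `H` lying in a sector". [folklore] -/
def GroundStateStabilityWithoutGroundState : Prop :=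
  ∀ (Λ : Type) [Fintype Λ] [DecidableEq Λ] (G : SimpleGraph Λ) [DecidableRel G.Adj], G.Connected →
    ∀ (Δ : ℝ) (μ : Λ → ℝ), |Δ| ≤ 1 → ∀ (M : ℝ) (ψ : TensorIndex Λ 2 → ℂ), ψ ∈ spinZSector 1 M → ψ ≠ 0 →
      (∃ E : ℂ, (xxzHamiltonian 1 G (-1) Δ + ∑ x : Λ, ((μ x : ℝ) : ℂ) • siteSpin 1 x 2).mulVec ψ = E • ψ) →
      ∀ z : Λ → ℂ, (∀ x, 0 < (z x).im) → (∑ S : Finset Λ, ψ (fun x => if x ∈ S then 0 else 1) * ∏ x ∈ S, z x) ≠ 0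

/-- **"Ground" is load-bearing** (not merely "eigen"): the two-site singlet is an (excited)
eigenvector of the ferromagnet `xxzHamiltonian 1 ⊤ (-1) 1 = -𝐒₀·𝐒₁` in the one-particle sector, with
polynomial `∝ z₀ - z₁`. Stability is a property of the bottom of each sector only. [folklore] -/
theorem groundStateStability_false_without_groundState : ¬ GroundStateStabilityWithoutGroundState := by
  intro h
  obtain ⟨ψ, hψ, hψ0, hH, z, hz, hzero⟩ := singlet_witness
  have hH0 : xxzHamiltonian 1 (⊤ : SimpleGraph (Fin 2)) (-1) 1 +
      ∑ x : Fin 2, (((fun _ : Fin 2 => (0 : ℝ)) x : ℝ) : ℂ) • siteSpin 1 x 2 =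
      -heisenbergHamiltonian 1 (⊤ : SimpleGraph (Fin 2)) 1 := by
    rw [xxzHamiltonian_one_eq_heisenberg, heisenbergHamiltonian_neg_one]
    simp
  refine h (Fin 2) (⊤ : SimpleGraph (Fin 2)) SimpleGraph.connected_top 1 (fun _ => 0) (by norm_num) _ ψ
    hψ hψ0 ⟨-((lowestEnergyInSector 1 (heisenbergHamiltonian 1 (⊤ : SimpleGraph (Fin 2)) 1)
          (((Fintype.card (Fin 2) * 1 : ℕ) : ℝ) / 2 - (1 : ℕ)) : ℝ) : ℂ), ?_⟩ z hz hzero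
  rw [hH0, Matrix.neg_mulVec, hH, neg_smul]

/-- The crux with the magnetisation-sector restriction removed: `ψ` a GLOBAL ground vector of `H`
(`E` a lower bound of the quadratic form and `Hψ = Eψ`). [folklore] -/
def GroundStateStabilityWithoutSector : Prop :=
  ∀ (Λ : Type) [Fintype Λ] [DecidableEq Λ] (G : SimpleGraph Λ) [DecidableRel G.Adj], G.Connected →
    ∀ (Δ : ℝ) (μ : Λ → ℝ), |Δ| ≤ 1 → ∀ (E : ℝ) (ψ : TensorIndex Λ 2 → ℂ), ψ ≠ 0 →
      (∀ φ : TensorIndex Λ 2 → ℂ, E * (star φ ⬝ᵥ φ).re ≤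
        (star φ ⬝ᵥ (xxzHamiltonian 1 G (-1) Δ + ∑ x : Λ, ((μ x : ℝ) : ℂ) • siteSpin 1 x 2) *ᵥ φ).re) →
      (xxzHamiltonian 1 G (-1) Δ + ∑ x : Λ, ((μ x : ℝ) : ℂ) • siteSpin 1 x 2).mulVec ψ = (E : ℂ) • ψ →
      ∀ z : Λ → ℂ, (∀ x, 0 < (z x).im) → (∑ S : Finset Λ, ψ (fun x => if x ∈ S then 0 else 1) * ∏ x ∈ S, z x) ≠ 0

/-- **The sector restriction is load-bearing**: on one site with no field (`H = 0`) the cross-sector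
superposition `|↑⟩ - i|↓⟩` is a global ground vector with polynomial `z₀ - i`, vanishing at `z₀ = i`.
(This is why the route's target selects the sector with a penalty `4L³(S³_tot + L³/2 - N)²`.) [folklore] -/
theorem groundStateStability_false_without_sector : ¬ GroundStateStabilityWithoutSector := by
  intro h
  have hE : (⊤ : SimpleGraph (Fin 1)).edgeFinset = ∅ := by
    ext e
    induction e using Sym2.ind with
    | h x y =>
      simp only [SimpleGraph.mem_edgeFinset, SimpleGraph.mem_edgeSet, SimpleGraph.top_adj,
        Finset.notMem_empty, iff_false, ne_eq, not_not]
      exact Subsingleton.elim x y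
  have hop0 : xxzHamiltonian 1 (⊤ : SimpleGraph (Fin 1)) (-1) 0 +
      ∑ x : Fin 1, (((fun _ : Fin 1 => (0 : ℝ)) x : ℝ) : ℂ) • siteSpin 1 x 2 = 0 := by
    simp [xxzHamiltonian, hE]
  let ψ : TensorIndex (Fin 1) 2 → ℂ := fun σ => if σ 0 = 0 then 1 else -I
  have hψ0 : ψ ≠ 0 := by
    intro h0
    have := congrFun h0 (fun _ => 0)
    simp [ψ] at this
  refine h (Fin 1) (⊤ : SimpleGraph (Fin 1)) SimpleGraph.connected_top 0 (fun _ => 0) (by norm_num) 0 ψ hψ0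
    ?_ ?_ (fun _ => I) (fun _ => by simp) ?_
  · intro φ
    rw [hop0]
    simp
  · rw [hop0]
    simp
  · -- Σ_S ψ(1_S) ∏_{x∈S} i over S ∈ {∅, {0}} = (-i) + i = 0
    have hvan : ∀ S : Finset (Fin 1), S ≠ ∅ ∧ S ≠ {0} →
        ψ (fun x => if x ∈ S then 0 else 1) * ∏ x ∈ S, (fun _ : Fin 1 => I) x = 0 := by
      intro S hS
      exfalso
      have : S = ∅ ∨ S = {0} := by
        revert S
        decide
      tauto
    rw [Fintype.sum_eq_add (∅ : Finset (Fin 1)) {0} (by decide) hvan, Finset.prod_empty,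
      Finset.prod_singleton]
    simp [ψ]

end LoadBearing

/-! ### Tightness of the window `|Δ| ≤ 1` -/

section Tightness

variable {Λ : Type*} [Fintype Λ] [DecidableEq Λ]

/-- Two single-site operators at distinct sites act on two coordinates. [folklore] -/
theorem onSite_mul_onSite_mulVec_apply {q : ℕ} {x y : Λ} (hxy : x ≠ y)
    (a b : Matrix (Fin q) (Fin q) ℂ) (φ : TensorIndex Λ q → ℂ) (σ : TensorIndex Λ q) :
    ((onSite x a * onSite y b : Op Λ q) *ᵥ φ) σ =
      ∑ l, ∑ m, a (σ x) l * b (σ y) m * φ (Function.update (Function.update σ x l) y m) := by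
  rw [← Matrix.mulVec_mulVec, LiebMattis.onSite_mulVec_apply]
  refine Finset.sum_congr rfl fun l _ => ?_
  rw [LiebMattis.onSite_mulVec_apply, Function.update_of_ne hxy.symm, Finset.mul_sum]
  refine Finset.sum_congr rfl fun m _ => ?_
  ring

/-- Swap the values of a configuration at two sites. -/
def swapAt (x y : Λ) (σ : TensorIndex Λ 2) : TensorIndex Λ 2 :=
  Function.update (Function.update σ x (σ y)) y (σ x)

/-- **Action of the spin-½ XXZ bond in the occupation basis**:
`(SˣSˣ+SʸSʸ+ΔSᶻSᶻ)_{xy} φ (σ) = Δ s_x s_y φ(σ) + ½[σ_x ≠ σ_y] φ(σ with x,y swapped)`,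
`s = ±½`. [folklore] -/
theorem xxzBond_mulVec_apply {x y : Λ} (hxy : x ≠ y) (Δ : ℂ) (φ : TensorIndex Λ 2 → ℂ)
    (σ : TensorIndex Λ 2) :
    ((spinBond 1 0 x y + spinBond 1 1 x y + Δ • spinBond 1 2 x y) *ᵥ φ) σ =
      Δ * (if σ x = σ y then (1 / 4 : ℂ) else -(1 / 4 : ℂ)) * φ σ +
        (if σ x = σ y then 0 else (1 / 2 : ℂ) * φ (swapAt x y σ)) := by
  have key : ∀ i : Fin 2, i = 0 ∨ i = 1 := by decide
  have hcomm : ∀ (l m : Fin 2), Function.update (Function.update σ y m) x l =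
      Function.update (Function.update σ x l) y m := fun l m => Function.update_comm hxy.symm _ _ _
  simp only [spinBond, siteSpin, spinVec_one_eq_half_spinHalfPauli, Matrix.add_mulVec,
    Matrix.smul_mulVec, Pi.add_apply, Pi.smul_apply, smul_eq_mul,
    onSite_mul_onSite_mulVec_apply hxy, onSite_mul_onSite_mulVec_apply hxy.symm, hcomm,
    Matrix.smul_apply, swapAt]
  have h1 : Function.update (Function.update σ x (σ x)) y (σ y) = σ := by
    simp only [Function.update_eq_self]
  rcases key (σ x) with hx | hx <;> rcases key (σ y) with hy | hy <;> rw [hx, hy] at h1 <;>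
    simp [hx, hy, spinHalfPauli, h1] <;> ring_nf <;> simp [Complex.I_sq] <;> ring


/-! ### The 4-cycle -/

/-- The 4-cycle `0 – 1 – 2 – 3 – 0`. -/
abbrev C4 : SimpleGraph (Fin 4) := SimpleGraph.cycleGraph 4

/-- The edge set of the 4-cycle. [folklore] -/
theorem C4_edgeFinset : C4.edgeFinset = {s(0, 1), s(1, 2), s(2, 3), s(3, 0)} := by
  decide

/-- Swaps along the four edges, on vector literals. -/
theorem swapAt_01 (a b c d : Fin 2) : swapAt (0 : Fin 4) 1 ![a, b, c, d] = ![b, a, c, d] := by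
  funext i; fin_cases i <;> simp [swapAt]
/-- Swap along the edge `{1,2}` on a vector literal. [folklore] -/
theorem swapAt_12 (a b c d : Fin 2) : swapAt (1 : Fin 4) 2 ![a, b, c, d] = ![a, c, b, d] := by
  funext i; fin_cases i <;> simp [swapAt]
/-- Swap along the edge `{2,3}` on a vector literal. [folklore] -/
theorem swapAt_23 (a b c d : Fin 2) : swapAt (2 : Fin 4) 3 ![a, b, c, d] = ![a, b, d, c] := by
  funext i; fin_cases i <;> simp [swapAt]
/-- Swap along the edge `{3,0}` on a vector literal. [folklore] -/
theorem swapAt_30 (a b c d : Fin 2) : swapAt (3 : Fin 4) 0 ![a, b, c, d] = ![d, b, c, a] := by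
  funext i; fin_cases i <;> simp [swapAt]

/-- parallel / antiparallel weight `q(u,v) = ±¼`. -/
def qq (u v : Fin 2) : ℂ := if u = v then (1 / 4 : ℂ) else -(1 / 4 : ℂ)
/-- hop indicator `[u ≠ v]/2`. -/
def hh (u v : Fin 2) : ℂ := if u = v then 0 else (1 / 2 : ℂ)

/-- **Master action formula**: the ferromagnetic XXZ Hamiltonian with zero field on the 4-cycle,
evaluated at the configuration `(a,b,c,d)`. -/
theorem H_C4_apply (Δ : ℝ) (φ : TensorIndex (Fin 4) 2 → ℂ) (a b c d : Fin 2) :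
    ((xxzHamiltonian 1 C4 (-1) Δ + ∑ x : Fin 4, (((fun _ : Fin 4 => (0 : ℝ)) x : ℝ) : ℂ) • siteSpin 1 x 2)
        *ᵥ φ) ![a, b, c, d] =
      -((Δ : ℂ) * (qq a b + qq b c + qq c d + qq d a) * φ ![a, b, c, d] +
        (hh a b * φ ![b, a, c, d] + hh b c * φ ![a, c, b, d] + hh c d * φ ![a, b, d, c] +
          hh d a * φ ![d, b, c, a])) := by
  have e01 : ((0 : Fin 4)) ≠ 1 := by decide
  have e12 : ((1 : Fin 4)) ≠ 2 := by decide
  have e23 : ((2 : Fin 4)) ≠ 3 := by decide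
  have e30 : ((3 : Fin 4)) ≠ 0 := by decide
  simp only [xxzHamiltonian, C4_edgeFinset, Complex.ofReal_zero, zero_smul, Finset.sum_const_zero,
    add_zero, Matrix.smul_mulVec, Pi.smul_apply, Matrix.sum_mulVec, Finset.sum_apply, smul_eq_mul]
  rw [Finset.sum_insert (by decide), Finset.sum_insert (by decide), Finset.sum_insert (by decide),
    Finset.sum_singleton]
  simp only [Sym2.lift_mk, xxzBond_mulVec_apply e01, xxzBond_mulVec_apply e12, xxzBond_mulVec_apply e23,
    xxzBond_mulVec_apply e30, qq, hh]
  simp [swapAt_01, swapAt_12, swapAt_23, swapAt_30]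
  split_ifs <;> ring

/-! ### The tightness witness at `Δ = -7/3` -/

/-- The field-free ferromagnetic XXZ Hamiltonian on the 4-cycle at `Δ = -7/3` (written exactly in
the shape the crux produces for `μ = 0`). -/
def H₀ : Op (Fin 4) 2 :=
  xxzHamiltonian 1 C4 (-1) (-7 / 3 : ℝ) +
    ∑ x : Fin 4, (((fun _ : Fin 4 => (0 : ℝ)) x : ℝ) : ℂ) • siteSpin 1 x 2

/-- The sector ground vector: `3` on the two diagonal pairs `{0,2}`, `{1,3}`, `1` on the four edges,
`0` off the two-particle sector. -/
def ψ₀ : TensorIndex (Fin 4) 2 → ℂ := fun σ =>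
  if (∑ z, (σ z : ℕ)) = 2 then (if σ 0 = σ 2 then 3 else 1) else 0

/-- Every configuration on four sites is a vector literal. [folklore] -/
theorem vec4_eta (σ : Fin 4 → Fin 2) : σ = ![σ 0, σ 1, σ 2, σ 3] := by
  funext i; fin_cases i <;> rfl

/-- `H₀ ψ₀ = -3 ψ₀`, configuration by configuration. -/
theorem H₀_mulVec_ψ₀_apply (a b c d : Fin 2) :
    (H₀ *ᵥ ψ₀) ![a, b, c, d] = (-3 : ℂ) * ψ₀ ![a, b, c, d] := by
  rw [H₀, H_C4_apply]
  fin_cases a <;> fin_cases b <;> fin_cases c <;> fin_cases d <;>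
    simp [ψ₀, qq, hh, Fin.sum_univ_four] <;> norm_num

/-- The eigen-equation `H₀ ψ₀ = -3 ψ₀`. [folklore] -/
theorem H₀_mulVec_ψ₀ : H₀ *ᵥ ψ₀ = (-3 : ℂ) • ψ₀ := by
  funext σ
  rw [vec4_eta σ, Pi.smul_apply, smul_eq_mul]
  exact H₀_mulVec_ψ₀_apply _ _ _ _

/-- `ψ₀` lies in the two-particle sector (`M = 4/2 - 2 = 0`). [folklore] -/
theorem ψ₀_mem : ψ₀ ∈ spinZSector 1 (((Fintype.card (Fin 4) * 1 : ℕ) : ℝ) / 2 - (2 : ℕ)) :=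
  (LiebMattis.mem_spinZSector_weight_iff 1 2 ψ₀).2 fun _ hσ => if_neg hσ

/-- `ψ₀ ≠ 0`. [folklore] -/
theorem ψ₀_ne_zero : ψ₀ ≠ 0 := by
  intro h
  have := congrFun h ![0, 1, 0, 1]
  simp [ψ₀, Fin.sum_univ_four] at this

/-- The six two-particle configurations. -/
def T6 : Finset (Fin 4 → Fin 2) :=
  {![0, 0, 1, 1], ![1, 0, 0, 1], ![1, 1, 0, 0], ![0, 1, 1, 0], ![0, 1, 0, 1], ![1, 0, 1, 0]}

/-- The two-particle configurations are the six listed ones. [folklore] -/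
theorem mem_T6_of_weight : ∀ σ : Fin 4 → Fin 2, (∑ z, (σ z : ℕ)) = 2 → σ ∈ T6 := by
  decide

/-- A sum of a function vanishing off the two-particle sector is the sum of its six sector values. -/
theorem sum_sector (f : (Fin 4 → Fin 2) → ℂ) (hf : ∀ σ, (∑ z, (σ z : ℕ)) ≠ 2 → f σ = 0) :
    ∑ σ, f σ = f ![0, 0, 1, 1] + f ![1, 0, 0, 1] + f ![1, 1, 0, 0] + f ![0, 1, 1, 0] +
      f ![0, 1, 0, 1] + f ![1, 0, 1, 0] := by
  rw [← Finset.sum_subset (Finset.subset_univ T6)]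
  · rw [T6, Finset.sum_insert (by decide), Finset.sum_insert (by decide), Finset.sum_insert (by decide),
      Finset.sum_insert (by decide), Finset.sum_insert (by decide), Finset.sum_singleton]
    ring
  · intro σ _ hσ
    exact hf σ fun h => hσ (mem_T6_of_weight σ h)

/-- **The sum-of-squares certificate** `⟨φ,(H₀+3)φ⟩ = 3Σ_i|a_i - s/6|² + ⅓|d₁-d₂|² ≥ 0` on the sector
(`a_i` the edge amplitudes, `d_j` the diagonal ones, `s = d₁+d₂`). -/
theorem quadForm_H₀ (φ : TensorIndex (Fin 4) 2 → ℂ) (hφ : ∀ σ, (∑ z, (σ z : ℕ)) ≠ 2 → φ σ = 0) :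
    (star φ ⬝ᵥ H₀ *ᵥ φ).re + 3 * (star φ ⬝ᵥ φ).re =
      3 * (((φ ![0, 0, 1, 1]).re - ((φ ![0, 1, 0, 1]).re + (φ ![1, 0, 1, 0]).re) / 6) ^ 2 +
            ((φ ![0, 0, 1, 1]).im - ((φ ![0, 1, 0, 1]).im + (φ ![1, 0, 1, 0]).im) / 6) ^ 2 +
          (((φ ![1, 0, 0, 1]).re - ((φ ![0, 1, 0, 1]).re + (φ ![1, 0, 1, 0]).re) / 6) ^ 2 +
            ((φ ![1, 0, 0, 1]).im - ((φ ![0, 1, 0, 1]).im + (φ ![1, 0, 1, 0]).im) / 6) ^ 2) +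
          (((φ ![1, 1, 0, 0]).re - ((φ ![0, 1, 0, 1]).re + (φ ![1, 0, 1, 0]).re) / 6) ^ 2 +
            ((φ ![1, 1, 0, 0]).im - ((φ ![0, 1, 0, 1]).im + (φ ![1, 0, 1, 0]).im) / 6) ^ 2) +
          (((φ ![0, 1, 1, 0]).re - ((φ ![0, 1, 0, 1]).re + (φ ![1, 0, 1, 0]).re) / 6) ^ 2 +
            ((φ ![0, 1, 1, 0]).im - ((φ ![0, 1, 0, 1]).im + (φ ![1, 0, 1, 0]).im) / 6) ^ 2)) +
        (1 / 3) * (((φ ![0, 1, 0, 1]).re - (φ ![1, 0, 1, 0]).re) ^ 2 +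
          ((φ ![0, 1, 0, 1]).im - (φ ![1, 0, 1, 0]).im) ^ 2) := by
  have h1 : ∀ σ, (∑ z, (σ z : ℕ)) ≠ 2 → star (φ σ) * (H₀ *ᵥ φ) σ = 0 := fun σ hσ => by
    rw [hφ σ hσ, star_zero, zero_mul]
  have h2 : ∀ σ, (∑ z, (σ z : ℕ)) ≠ 2 → star (φ σ) * φ σ = 0 := fun σ hσ => by
    rw [hφ σ hσ, star_zero, zero_mul]
  simp only [dotProduct, Pi.star_apply]
  rw [sum_sector _ h1, sum_sector _ h2]
  simp only [H₀, H_C4_apply, qq, hh]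
  simp [Complex.mul_re, Complex.mul_im]
  ring

/-- `⟨φ,(H₀+3)φ⟩ ≥ 0` on the sector. [folklore] -/
theorem quadForm_H₀_nonneg (φ : TensorIndex (Fin 4) 2 → ℂ) (hφ : ∀ σ, (∑ z, (σ z : ℕ)) ≠ 2 → φ σ = 0) :
    0 ≤ (star φ ⬝ᵥ H₀ *ᵥ φ).re + 3 * (star φ ⬝ᵥ φ).re := by
  rw [quadForm_H₀ φ hφ]
  positivity

/-- The sector energy is exactly `-3`. -/
theorem lowestEnergyInSector_H₀ :
    lowestEnergyInSector 1 H₀ (((Fintype.card (Fin 4) * 1 : ℕ) : ℝ) / 2 - (2 : ℕ)) = -3 := by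
  unfold lowestEnergyInSector Matrix.minEnergyOn
  set K := spinZSector (Λ := Fin 4) 1 (((Fintype.card (Fin 4) * 1 : ℕ) : ℝ) / 2 - (2 : ℕ)) with hK
  have hlow : ∀ E ∈ {E : ℝ | ∃ ψ ∈ K, star ψ ⬝ᵥ ψ = 1 ∧ E = (star ψ ⬝ᵥ H₀ *ᵥ ψ).re}, -3 ≤ E := by
    rintro E ⟨φ, hφK, hφ1, rfl⟩
    have hφ := (LiebMattis.mem_spinZSector_weight_iff 1 2 φ).1 hφK
    have h := quadForm_H₀_nonneg φ hφ
    rw [hφ1, Complex.one_re] at h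
    linarith
  have hmem : (-3 : ℝ) ∈ {E : ℝ | ∃ ψ ∈ K, star ψ ⬝ᵥ ψ = 1 ∧ E = (star ψ ⬝ᵥ H₀ *ᵥ ψ).re} := by
    obtain ⟨c, -, hc1⟩ := exists_smul_unit ψ₀_ne_zero
    refine ⟨c • ψ₀, K.smul_mem c ψ₀_mem, hc1, ?_⟩
    rw [Matrix.mulVec_smul, H₀_mulVec_ψ₀, smul_comm, dotProduct_smul, hc1]
    simp
  exact le_antisymm (csInf_le ⟨-3, hlow⟩ hmem) (le_csInf ⟨-3, hmem⟩ hlow)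

/-- The occupation polynomial of `ψ₀`, `3(z₀z₂ + z₁z₃) + (z₀z₁ + z₁z₂ + z₂z₃ + z₃z₀)`, vanishes at the
Gaussian-integer point `(3+i, -4+2i, 3+i, -2+i) ∈ H⁴`. -/
theorem ψ₀_poly_zero :
    (∑ S : Finset (Fin 4), ψ₀ (fun x => if x ∈ S then 0 else 1) *
        ∏ x ∈ S, (![3 + I, -4 + 2 * I, 3 + I, -2 + I] : Fin 4 → ℂ) x) = 0 := by
  have hvan : ∀ S : Finset (Fin 4), S ∉ ({{0, 1}, {0, 2}, {0, 3}, {1, 2}, {1, 3}, {2, 3}} : Finset (Finset (Fin 4))) →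
      (∑ z, (((fun x => if x ∈ S then (0 : Fin 2) else 1) z : Fin 2) : ℕ)) ≠ 2 := by
    decide
  rw [← Finset.sum_subset (Finset.subset_univ ({{0, 1}, {0, 2}, {0, 3}, {1, 2}, {1, 3}, {2, 3}} : Finset (Finset (Fin 4))))]
  · rw [Finset.sum_insert (by decide), Finset.sum_insert (by decide), Finset.sum_insert (by decide),
      Finset.sum_insert (by decide), Finset.sum_insert (by decide), Finset.sum_singleton,
      Finset.prod_pair (by decide), Finset.prod_pair (by decide), Finset.prod_pair (by decide),
      Finset.prod_pair (by decide), Finset.prod_pair (by decide), Finset.prod_pair (by decide)]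
    simp [ψ₀, Fin.sum_univ_four]
    ring_nf
    simp [Complex.I_sq]
  · intro S _ hS
    rw [ψ₀, if_neg (hvan S hS), zero_mul]

/-! ### The crux with a wider window is false -/

/-- The crux with the window `|Δ| ≤ 1` replaced by `|Δ| ≤ w`. -/
def GroundStateStabilityWithWindow (w : ℝ) : Prop :=
  ∀ (Λ : Type) [Fintype Λ] [DecidableEq Λ] (G : SimpleGraph Λ) [DecidableRel G.Adj], G.Connected →
    ∀ (Δ : ℝ) (μ : Λ → ℝ), |Δ| ≤ w → ∀ (M : ℝ) (ψ : TensorIndex Λ 2 → ℂ), ψ ∈ spinZSector 1 M → ψ ≠ 0 →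
      (xxzHamiltonian 1 G (-1) Δ + ∑ x : Λ, ((μ x : ℝ) : ℂ) • siteSpin 1 x 2).mulVec ψ =
        ((lowestEnergyInSector 1 (xxzHamiltonian 1 G (-1) Δ + ∑ x : Λ, ((μ x : ℝ) : ℂ) • siteSpin 1 x 2) M : ℝ) : ℂ) • ψ →
      ∀ z : Λ → ℂ, (∀ x, 0 < (z x).im) → (∑ S : Finset Λ, ψ (fun x => if x ∈ S then 0 else 1) * ∏ x ∈ S, z x) ≠ 0

/-- `GroundStateStabilityWithWindow 1` is the crux, verbatim. [folklore] -/
theorem groundStateStabilityWithWindow_one_iff :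
    GroundStateStabilityWithWindow 1 ↔
      Summit.AtomisticToContinuum.BoseEinsteinCondensation.Theses.BECStronglyRayleigh.GroundStateStability :=
  Iff.rfl

/-- **The window cannot be widened to `|Δ| ≤ 7/3`** (repulsive side, `Δ = -7/3`, 4-cycle, two
particles, no field): the sector ground vector `ψ₀` has an occupation polynomial with a zero in `H⁴`. -/
theorem groundStateStability_false_with_window : ¬ GroundStateStabilityWithWindow (7 / 3) := by
  intro h
  have hH : (xxzHamiltonian 1 C4 (-1) (-7 / 3 : ℝ) +
      ∑ x : Fin 4, (((fun _ : Fin 4 => (0 : ℝ)) x : ℝ) : ℂ) • siteSpin 1 x 2) = H₀ := rfl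
  refine h (Fin 4) C4 SimpleGraph.cycleGraph_connected (-7 / 3) (fun _ => 0)
    (by rw [abs_le]; constructor <;> norm_num) _ ψ₀ ψ₀_mem ψ₀_ne_zero ?_
    ![3 + I, -4 + 2 * I, 3 + I, -2 + I] ?_ ψ₀_poly_zero
  · rw [hH, lowestEnergyInSector_H₀, H₀_mulVec_ψ₀]
    push_cast
    ring_nf
  · intro x
    fin_cases x <;> simp

/-! ### The squared amplitudes (Born weights) are NOT strongly Rayleigh inside the window -/

/-- The field-free ferromagnetic XXZ Hamiltonian on the 4-cycle at `Δ = -1/6` (inside the window). -/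
def H₁ : Op (Fin 4) 2 :=
  xxzHamiltonian 1 C4 (-1) (-1 / 6 : ℝ) +
    ∑ x : Fin 4, (((fun _ : Fin 4 => (0 : ℝ)) x : ℝ) : ℂ) • siteSpin 1 x 2

/-- Its sector ground vector: `3` on the diagonal pairs, `2` on the edges. -/
def ψ₁ : TensorIndex (Fin 4) 2 → ℂ := fun σ =>
  if (∑ z, (σ z : ℕ)) = 2 then (if σ 0 = σ 2 then 3 else 2) else 0

/-- `H₁ ψ₁ = -(3/2) ψ₁`, configuration by configuration. [folklore] -/
theorem H₁_mulVec_ψ₁_apply (a b c d : Fin 2) :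
    (H₁ *ᵥ ψ₁) ![a, b, c, d] = (-(3 / 2) : ℂ) * ψ₁ ![a, b, c, d] := by
  rw [H₁, H_C4_apply]
  fin_cases a <;> fin_cases b <;> fin_cases c <;> fin_cases d <;>
    simp [ψ₁, qq, hh, Fin.sum_univ_four] <;> norm_num

/-- The eigen-equation `H₁ ψ₁ = -(3/2) ψ₁`. [folklore] -/
theorem H₁_mulVec_ψ₁ : H₁ *ᵥ ψ₁ = (-(3 / 2) : ℂ) • ψ₁ := by
  funext σ
  rw [vec4_eta σ, Pi.smul_apply, smul_eq_mul]
  exact H₁_mulVec_ψ₁_apply _ _ _ _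

/-- `ψ₁` lies in the two-particle sector. [folklore] -/
theorem ψ₁_mem : ψ₁ ∈ spinZSector 1 (((Fintype.card (Fin 4) * 1 : ℕ) : ℝ) / 2 - (2 : ℕ)) :=
  (LiebMattis.mem_spinZSector_weight_iff 1 2 ψ₁).2 fun _ hσ => if_neg hσ

/-- `ψ₁ ≠ 0`. [folklore] -/
theorem ψ₁_ne_zero : ψ₁ ≠ 0 := by
  intro h
  have := congrFun h ![0, 1, 0, 1]
  simp [ψ₁, Fin.sum_univ_four] at this

/-- Sum-of-squares certificate `⟨φ,(H₁+3/2)φ⟩ = (3/2)Σ_i|a_i - s/3|² + (2/3)|d₁-d₂|²`. [folklore] -/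
theorem quadForm_H₁ (φ : TensorIndex (Fin 4) 2 → ℂ) (hφ : ∀ σ, (∑ z, (σ z : ℕ)) ≠ 2 → φ σ = 0) :
    (star φ ⬝ᵥ H₁ *ᵥ φ).re + 3 / 2 * (star φ ⬝ᵥ φ).re =
      3 / 2 * (((φ ![0, 0, 1, 1]).re - ((φ ![0, 1, 0, 1]).re + (φ ![1, 0, 1, 0]).re) / 3) ^ 2 +
            ((φ ![0, 0, 1, 1]).im - ((φ ![0, 1, 0, 1]).im + (φ ![1, 0, 1, 0]).im) / 3) ^ 2 +
          (((φ ![1, 0, 0, 1]).re - ((φ ![0, 1, 0, 1]).re + (φ ![1, 0, 1, 0]).re) / 3) ^ 2 +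
            ((φ ![1, 0, 0, 1]).im - ((φ ![0, 1, 0, 1]).im + (φ ![1, 0, 1, 0]).im) / 3) ^ 2) +
          (((φ ![1, 1, 0, 0]).re - ((φ ![0, 1, 0, 1]).re + (φ ![1, 0, 1, 0]).re) / 3) ^ 2 +
            ((φ ![1, 1, 0, 0]).im - ((φ ![0, 1, 0, 1]).im + (φ ![1, 0, 1, 0]).im) / 3) ^ 2) +
          (((φ ![0, 1, 1, 0]).re - ((φ ![0, 1, 0, 1]).re + (φ ![1, 0, 1, 0]).re) / 3) ^ 2 +
            ((φ ![0, 1, 1, 0]).im - ((φ ![0, 1, 0, 1]).im + (φ ![1, 0, 1, 0]).im) / 3) ^ 2)) +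
        (2 / 3) * (((φ ![0, 1, 0, 1]).re - (φ ![1, 0, 1, 0]).re) ^ 2 +
          ((φ ![0, 1, 0, 1]).im - (φ ![1, 0, 1, 0]).im) ^ 2) := by
  have h1 : ∀ σ, (∑ z, (σ z : ℕ)) ≠ 2 → star (φ σ) * (H₁ *ᵥ φ) σ = 0 := fun σ hσ => by
    rw [hφ σ hσ, star_zero, zero_mul]
  have h2 : ∀ σ, (∑ z, (σ z : ℕ)) ≠ 2 → star (φ σ) * φ σ = 0 := fun σ hσ => by
    rw [hφ σ hσ, star_zero, zero_mul]
  simp only [dotProduct, Pi.star_apply]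
  rw [sum_sector _ h1, sum_sector _ h2]
  simp only [H₁, H_C4_apply, qq, hh]
  simp [Complex.mul_re, Complex.mul_im]
  ring

/-- The sector energy of `H₁` is exactly `-3/2`. [folklore] -/
theorem lowestEnergyInSector_H₁ :
    lowestEnergyInSector 1 H₁ (((Fintype.card (Fin 4) * 1 : ℕ) : ℝ) / 2 - (2 : ℕ)) = -(3 / 2) := by
  unfold lowestEnergyInSector Matrix.minEnergyOn
  set K := spinZSector (Λ := Fin 4) 1 (((Fintype.card (Fin 4) * 1 : ℕ) : ℝ) / 2 - (2 : ℕ)) with hK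
  have hlow : ∀ E ∈ {E : ℝ | ∃ ψ ∈ K, star ψ ⬝ᵥ ψ = 1 ∧ E = (star ψ ⬝ᵥ H₁ *ᵥ ψ).re}, -(3 / 2) ≤ E := by
    rintro E ⟨φ, hφK, hφ1, rfl⟩
    have hφ := (LiebMattis.mem_spinZSector_weight_iff 1 2 φ).1 hφK
    have h := quadForm_H₁ φ hφ
    rw [hφ1, Complex.one_re] at h
    nlinarith [h, sq_nonneg ((φ ![0, 0, 1, 1]).re - ((φ ![0, 1, 0, 1]).re + (φ ![1, 0, 1, 0]).re) / 3),
      sq_nonneg ((φ ![0, 0, 1, 1]).im - ((φ ![0, 1, 0, 1]).im + (φ ![1, 0, 1, 0]).im) / 3),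
      sq_nonneg ((φ ![1, 0, 0, 1]).re - ((φ ![0, 1, 0, 1]).re + (φ ![1, 0, 1, 0]).re) / 3),
      sq_nonneg ((φ ![1, 0, 0, 1]).im - ((φ ![0, 1, 0, 1]).im + (φ ![1, 0, 1, 0]).im) / 3),
      sq_nonneg ((φ ![1, 1, 0, 0]).re - ((φ ![0, 1, 0, 1]).re + (φ ![1, 0, 1, 0]).re) / 3),
      sq_nonneg ((φ ![1, 1, 0, 0]).im - ((φ ![0, 1, 0, 1]).im + (φ ![1, 0, 1, 0]).im) / 3),
      sq_nonneg ((φ ![0, 1, 1, 0]).re - ((φ ![0, 1, 0, 1]).re + (φ ![1, 0, 1, 0]).re) / 3),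
      sq_nonneg ((φ ![0, 1, 1, 0]).im - ((φ ![0, 1, 0, 1]).im + (φ ![1, 0, 1, 0]).im) / 3),
      sq_nonneg ((φ ![0, 1, 0, 1]).re - (φ ![1, 0, 1, 0]).re),
      sq_nonneg ((φ ![0, 1, 0, 1]).im - (φ ![1, 0, 1, 0]).im)]
  have hmem : (-(3 / 2) : ℝ) ∈ {E : ℝ | ∃ ψ ∈ K, star ψ ⬝ᵥ ψ = 1 ∧ E = (star ψ ⬝ᵥ H₁ *ᵥ ψ).re} := by
    obtain ⟨c, -, hc1⟩ := exists_smul_unit ψ₁_ne_zero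
    refine ⟨c • ψ₁, K.smul_mem c ψ₁_mem, hc1, ?_⟩
    rw [Matrix.mulVec_smul, H₁_mulVec_ψ₁, smul_comm, dotProduct_smul, hc1]
    norm_num
  exact le_antisymm (csInf_le ⟨-(3 / 2), hlow⟩ hmem) (le_csInf ⟨-(3 / 2), hmem⟩ hlow)

/-- The SQUARED-amplitude polynomial of `ψ₁`, `9(z₀z₂+z₁z₃) + 4(z₀z₁+z₁z₂+z₂z₃+z₃z₀)`, vanishes at
`(6+2i, -6+i, 6+i, -6+2i) ∈ H⁴`. [folklore] -/
theorem ψ₁_sq_poly_zero :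
    (∑ S : Finset (Fin 4), ψ₁ (fun x => if x ∈ S then 0 else 1) ^ 2 *
        ∏ x ∈ S, (![6 + 2 * I, -6 + I, 6 + I, -6 + 2 * I] : Fin 4 → ℂ) x) = 0 := by
  have hvan : ∀ S : Finset (Fin 4), S ∉ ({{0, 1}, {0, 2}, {0, 3}, {1, 2}, {1, 3}, {2, 3}} : Finset (Finset (Fin 4))) →
      (∑ z, (((fun x => if x ∈ S then (0 : Fin 2) else 1) z : Fin 2) : ℕ)) ≠ 2 := by
    decide
  rw [← Finset.sum_subset (Finset.subset_univ ({{0, 1}, {0, 2}, {0, 3}, {1, 2}, {1, 3}, {2, 3}} : Finset (Finset (Fin 4))))]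
  · rw [Finset.sum_insert (by decide), Finset.sum_insert (by decide), Finset.sum_insert (by decide),
      Finset.sum_insert (by decide), Finset.sum_insert (by decide), Finset.sum_singleton,
      Finset.prod_pair (by decide), Finset.prod_pair (by decide), Finset.prod_pair (by decide),
      Finset.prod_pair (by decide), Finset.prod_pair (by decide), Finset.prod_pair (by decide)]
    simp [ψ₁, Fin.sum_univ_four]
    ring_nf
    simp [Complex.I_sq]
  · intro S _ hS
    rw [ψ₁, if_neg (hvan S hS)]
    simp

/-- The crux with the conclusion strengthened from the amplitudes `ψ(1_S)` to their SQUARES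
(for the Perron ground vector: the Born weights `|Ψ₀(S)|²`, the law of the boson positions). -/
def GroundStateStabilitySquared : Prop :=
  ∀ (Λ : Type) [Fintype Λ] [DecidableEq Λ] (G : SimpleGraph Λ) [DecidableRel G.Adj], G.Connected →
    ∀ (Δ : ℝ) (μ : Λ → ℝ), |Δ| ≤ 1 → ∀ (M : ℝ) (ψ : TensorIndex Λ 2 → ℂ), ψ ∈ spinZSector 1 M → ψ ≠ 0 →
      (xxzHamiltonian 1 G (-1) Δ + ∑ x : Λ, ((μ x : ℝ) : ℂ) • siteSpin 1 x 2).mulVec ψ =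
        ((lowestEnergyInSector 1 (xxzHamiltonian 1 G (-1) Δ + ∑ x : Λ, ((μ x : ℝ) : ℂ) • siteSpin 1 x 2) M : ℝ) : ℂ) • ψ →
      ∀ z : Λ → ℂ, (∀ x, 0 < (z x).im) →
        (∑ S : Finset Λ, ψ (fun x => if x ∈ S then 0 else 1) ^ 2 * ∏ x ∈ S, z x) ≠ 0

/-- **The Born weights `|Ψ₀|²` are not strongly Rayleigh in general, even deep inside the window**
(refutes the natural strengthening "conjecture P" beyond pure hopping): 4-cycle, two particles, no
field, `Δ = -1/6`; the sector ground vector `ψ₁ = (3` on diagonals`, 2` on edges`)` is stable (pair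
kernel `circ(0,2,3,2)`, `3 ≤ 2·2`), but `ψ₁²  = (9, 4)` has pair kernel `circ(0,4,9,4)` with eigenvalues
`17, 1, -9, -9` — two positive. By hand: on `C4`, `N = 2`, `μ = 0`, `ψ²` is stable iff `a² ≤ 2b²` iff
`Δ ≥ 0`, with equality (criticality) exactly at the pure-hopping point `Δ = 0`. [folklore] -/
theorem groundStateStability_false_squared : ¬ GroundStateStabilitySquared := by
  intro h
  have hH : (xxzHamiltonian 1 C4 (-1) (-1 / 6 : ℝ) +
      ∑ x : Fin 4, (((fun _ : Fin 4 => (0 : ℝ)) x : ℝ) : ℂ) • siteSpin 1 x 2) = H₁ := rfl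
  refine h (Fin 4) C4 SimpleGraph.cycleGraph_connected (-1 / 6) (fun _ => 0)
    (by rw [abs_le]; constructor <;> norm_num) _ ψ₁ ψ₁_mem ψ₁_ne_zero ?_
    ![6 + 2 * I, -6 + I, 6 + I, -6 + 2 * I] ?_ ψ₁_sq_poly_zero
  · rw [hH, lowestEnergyInSector_H₁, H₁_mulVec_ψ₁]
    push_cast
    ring_nf
  · intro x
    fin_cases x <;> simp


end Tightness

end Summit.AtomisticToContinuum.BoseEinsteinCondensation.Cruxes.GroundStateStability.Disproof
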